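import Mathlib.Data.Fin.VecNotation
import Summits.Ventures.PercRepro.ThetaTransversals
import Summits.Ventures.PercRepro.MSRMStarThetaTwoPairs

/-!
# (Θ_∞): the (Θ)-difference family of any number of classes

Dossier proofs/MINE1-theoremS.md, Addendum 72 (mine-1, gen 37). For classes
`A : ι → Finset (Finset α)` the **multi-class difference family** is
`multiD A = {∅} ∪ ⋃ᵢ (A i \\ A i) ∪ ⋃_{i ≠ j} (A i ⊼ A j ∪ (A i ⊻ A j)*)` — the within-class
differences together with the cross-class meets and co-joins (`crossD`) — and an instance is
**valid** (`MultiValid A`) when the `2|ι|` families `A i`, `(A i)*` are pairwise disjoint.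
**Conjecture (Θ_∞)** (`ConjThetaMulti α`) says `∑ᵢ |A i| ≤ |multiD A|` for every valid instance
with any number of classes (census: 0 violations on `[3]`, `[4]` to `k = 8`, `[5]` to `k = 6`,
random and annealing to `[7]`; the arbitrary-type-graph generalisation is false). This file types
the conjecture and proves what closes:

* `multiD_fin1`, `card_le_card_multiD_one` — one class is Marica–Schönheim;
* `mem_multiD_fin2`, `card_add_card_le_card_multiD_two` — two classes: Marica–Schönheim for the
  transversal `A ∪ B*` (only `Disjoint A (compls B)` is needed);
* `multiD_fin3_eq : multiD ![A, B, C] = {∅} ∪ thetaD A B C` and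
  `multiValid_fin3_iff : MultiValid ![A, B, C] ↔ ThetaValid A B C` — three classes are the
  cell's (Θ); hence `theta_of_conjThetaMulti` ((Θ_∞) implies (Θ)) and
  `multi_three_of_some_card_le_two` (the proven regime «some type ≤ 2 pairs» is the three-class
  case of (Θ_∞));
* `multiD_comp_equiv`, `crossD_comm` — relabelling the classes changes nothing.
-/

namespace PercRepro.MSTight

open Finset
open scoped FinsetFamily

variable {α : Type*} [DecidableEq α] [Fintype α]

section Defs

variable {ι : Type*} [DecidableEq ι] [Fintype ι]

/-- The **cross term** of two classes: their meets and co-joins. -/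
def crossD (A B : Finset (Finset α)) : Finset (Finset α) := A ⊼ B ∪ compls (A ⊻ B)

/-- The **multi-class (Θ)-difference family**: `∅`, the within-class differences and the
cross-class meets and co-joins. -/
def multiD (A : ι → Finset (Finset α)) : Finset (Finset α) :=
  {∅} ∪ univ.biUnion (fun i => A i \\ A i) ∪
    (univ.filter fun p : ι × ι => p.1 ≠ p.2).biUnion fun p => crossD (A p.1) (A p.2)

/-- **Validity of a multi-class instance**: the families and their complement families are
pairwise disjoint. -/
def MultiValid (A : ι → Finset (Finset α)) : Prop :=
  (∀ i, Disjoint (A i) (compls (A i))) ∧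
    ∀ i j, i ≠ j → Disjoint (A i) (A j) ∧ Disjoint (A i) (compls (A j))

/-- Membership in the multi-class difference family. -/
theorem mem_multiD {A : ι → Finset (Finset α)} {E : Finset α} :
    E ∈ multiD A ↔ E = ∅ ∨ (∃ i, E ∈ A i \\ A i) ∨ ∃ i j, i ≠ j ∧ E ∈ crossD (A i) (A j) := by
  unfold multiD
  simp only [mem_union, mem_singleton, mem_biUnion, mem_univ, true_and, mem_filter, Prod.exists,
    or_assoc]

/-- The cross term is symmetric. -/
theorem crossD_comm (A B : Finset (Finset α)) : crossD A B = crossD B A := by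
  unfold crossD
  rw [infs_comm, sups_comm]

/-- `∅` is a multi-class difference. -/
theorem empty_mem_multiD (A : ι → Finset (Finset α)) : ∅ ∈ multiD A :=
  mem_multiD.2 (Or.inl rfl)

/-- Within-class differences are multi-class differences. -/
theorem mem_multiD_of_mem_diffs {A : ι → Finset (Finset α)} {E : Finset α} (i : ι)
    (h : E ∈ A i \\ A i) : E ∈ multiD A :=
  mem_multiD.2 (Or.inr (Or.inl ⟨i, h⟩))

/-- Cross-class meets and co-joins are multi-class differences. -/
theorem mem_multiD_of_mem_crossD {A : ι → Finset (Finset α)} {E : Finset α} {i j : ι}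
    (hij : i ≠ j) (h : E ∈ crossD (A i) (A j)) : E ∈ multiD A :=
  mem_multiD.2 (Or.inr (Or.inr ⟨i, j, hij, h⟩))

/-- Relabelling the classes along an equivalence does not change the family. -/
theorem multiD_comp_equiv {κ : Type*} [DecidableEq κ] [Fintype κ] (A : ι → Finset (Finset α))
    (e : κ ≃ ι) : multiD (A ∘ e) = multiD A := by
  ext E
  simp only [mem_multiD, Function.comp_apply]
  constructor
  · rintro (h | ⟨i, h⟩ | ⟨i, j, hij, h⟩)
    · exact Or.inl h
    · exact Or.inr (Or.inl ⟨e i, h⟩)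
    · exact Or.inr (Or.inr ⟨e i, e j, e.injective.ne hij, h⟩)
  · rintro (h | ⟨i, h⟩ | ⟨i, j, hij, h⟩)
    · exact Or.inl h
    · exact Or.inr (Or.inl ⟨e.symm i, by simpa using h⟩)
    · exact Or.inr (Or.inr ⟨e.symm i, e.symm j, e.symm.injective.ne hij, by simpa using h⟩)

omit [DecidableEq ι] [Fintype ι] in
/-- Validity is preserved by relabelling. -/
theorem multiValid_comp_equiv {κ : Type*} [DecidableEq κ] [Fintype κ]
    {A : ι → Finset (Finset α)} (e : κ ≃ ι) (h : MultiValid A) : MultiValid (A ∘ e) :=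
  ⟨fun i => h.1 (e i), fun i j hij => h.2 (e i) (e j) (e.injective.ne hij)⟩

end Defs

/-- **Conjecture (Θ_∞)** on the type `α`: for every number `m` of classes and every valid
instance `A : Fin m → Finset (Finset α)`, `∑ᵢ |A i| ≤ |multiD A|`. `m = 1` is Marica–Schönheim
(`card_le_card_multiD_one`), `m = 2` the two-type theorem (`card_add_card_le_card_multiD_two`),
`m = 3` the cell's (Θ) (`multiD_fin3_eq`); `m ≥ 4` is open (Addendum 72: census-true on `[3]`,
`[4]` to `k = 8`, `[5]` to `k = 6`). -/
def ConjThetaMulti (α : Type*) [DecidableEq α] [Fintype α] : Prop :=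
  ∀ (m : ℕ) (A : Fin m → Finset (Finset α)), MultiValid A → ∑ i, (A i).card ≤ (multiD A).card

section Small

variable (A B C : Finset (Finset α))

/-- One class: `multiD = {∅} ∪ A \\ A`. -/
theorem multiD_fin1 : multiD (fun _ : Fin 1 => A) = {∅} ∪ A \\ A := by
  ext E
  simp only [mem_multiD, mem_union, mem_singleton]
  constructor
  · rintro (h | ⟨_, h⟩ | ⟨i, j, hij, -⟩)
    · exact Or.inl h
    · exact Or.inr h
    · exact absurd (Subsingleton.elim i j) hij
  · rintro (h | h)
    · exact Or.inl h
    · exact Or.inr (Or.inl ⟨0, h⟩)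

/-- **(Θ_∞) for one class** — Marica–Schönheim. -/
theorem card_le_card_multiD_one : A.card ≤ (multiD fun _ : Fin 1 => A).card := by
  rw [multiD_fin1]
  exact (card_le_card_diffs A).trans (card_le_card subset_union_right)

/-- Differences of a complement family against a family are co-joins: `B* \\ A = (B ⊻ A)*`. -/
theorem compls_diffs_eq_compls_sups : compls B \\ A = compls (B ⊻ A) := by
  conv_lhs => rw [← compls_compls A]
  rw [diffs_compls_eq_infs, infs_compls_compls]

/-- Membership for two classes. -/
theorem mem_multiD_fin2 {E : Finset α} :
    E ∈ multiD ![A, B] ↔ E = ∅ ∨ E ∈ A \\ A ∨ E ∈ B \\ B ∨ E ∈ crossD A B := by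
  rw [mem_multiD]
  constructor
  · rintro (h | ⟨i, h⟩ | ⟨i, j, hij, h⟩)
    · exact Or.inl h
    · fin_cases i
      · exact Or.inr (Or.inl h)
      · exact Or.inr (Or.inr (Or.inl h))
    · fin_cases i <;> fin_cases j
      · exact absurd rfl hij
      · exact Or.inr (Or.inr (Or.inr h))
      · exact Or.inr (Or.inr (Or.inr (crossD_comm B A ▸ h)))
      · exact absurd rfl hij
  · rintro (h | h | h | h)
    · exact Or.inl h
    · exact Or.inr (Or.inl ⟨0, h⟩)
    · exact Or.inr (Or.inl ⟨1, h⟩)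
    · exact Or.inr (Or.inr ⟨0, 1, by decide, h⟩)

/-- Two classes: the differences of the transversal `A ∪ B*` are multi-class differences. -/
theorem diffs_transversal_subset_multiD_fin2 :
    (A ∪ compls B) \\ (A ∪ compls B) ⊆ multiD ![A, B] := by
  intro E hE
  rw [diffs_union_left, diffs_union_right, diffs_union_right, diffs_compls_compls,
    diffs_compls_eq_infs, compls_diffs_eq_compls_sups, sups_comm] at hE
  rw [mem_multiD_fin2]
  unfold crossD
  simp only [mem_union] at hE ⊢
  tauto

/-- **(Θ_∞) for two classes** — Marica–Schönheim for the transversal `A ∪ B*`; only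
`Disjoint A (compls B)` is used. -/
theorem card_add_card_le_card_multiD_two (h : Disjoint A (compls B)) :
    A.card + B.card ≤ (multiD ![A, B]).card := by
  have hF : (A ∪ compls B).card = A.card + B.card := by
    rw [card_union_of_disjoint h, card_compls]
  calc A.card + B.card = (A ∪ compls B).card := hF.symm
    _ ≤ ((A ∪ compls B) \\ (A ∪ compls B)).card := card_le_card_diffs _
    _ ≤ (multiD ![A, B]).card := card_le_card (diffs_transversal_subset_multiD_fin2 A B)

/-- Membership for three classes. -/
theorem mem_multiD_fin3 {E : Finset α} :
    E ∈ multiD ![A, B, C] ↔ E = ∅ ∨ E ∈ A \\ A ∨ E ∈ B \\ B ∨ E ∈ C \\ C ∨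
      E ∈ crossD A B ∨ E ∈ crossD B C ∨ E ∈ crossD C A := by
  rw [mem_multiD]
  constructor
  · rintro (h | ⟨i, h⟩ | ⟨i, j, hij, h⟩)
    · exact Or.inl h
    · fin_cases i
      · exact Or.inr (Or.inl h)
      · exact Or.inr (Or.inr (Or.inl h))
      · exact Or.inr (Or.inr (Or.inr (Or.inl h)))
    · fin_cases i <;> fin_cases j
      · exact absurd rfl hij
      · exact Or.inr (Or.inr (Or.inr (Or.inr (Or.inl h))))
      · exact Or.inr (Or.inr (Or.inr (Or.inr (Or.inr (Or.inr (crossD_comm A C ▸ h))))))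
      · exact Or.inr (Or.inr (Or.inr (Or.inr (Or.inl (crossD_comm B A ▸ h)))))
      · exact absurd rfl hij
      · exact Or.inr (Or.inr (Or.inr (Or.inr (Or.inr (Or.inl h)))))
      · exact Or.inr (Or.inr (Or.inr (Or.inr (Or.inr (Or.inr h)))))
      · exact Or.inr (Or.inr (Or.inr (Or.inr (Or.inr (Or.inl (crossD_comm C B ▸ h))))))
      · exact absurd rfl hij
  · rintro (h | h | h | h | h | h | h)
    · exact Or.inl h
    · exact Or.inr (Or.inl ⟨0, h⟩)
    · exact Or.inr (Or.inl ⟨1, h⟩)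
    · exact Or.inr (Or.inl ⟨2, h⟩)
    · exact Or.inr (Or.inr ⟨0, 1, by decide, h⟩)
    · exact Or.inr (Or.inr ⟨1, 2, by decide, h⟩)
    · exact Or.inr (Or.inr ⟨2, 0, by decide, h⟩)

/-- **Three classes are the cell's (Θ)**: `multiD ![A, B, C] = {∅} ∪ thetaD A B C`. -/
theorem multiD_fin3_eq : multiD ![A, B, C] = {∅} ∪ thetaD A B C := by
  ext E
  rw [mem_multiD_fin3, mem_union, mem_singleton]
  unfold thetaD crossD
  simp only [mem_union]
  tauto

/-- `thetaD A B C ⊆ multiD ![A, B, C]`. -/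
theorem thetaD_subset_multiD_fin3 : thetaD A B C ⊆ multiD ![A, B, C] := by
  rw [multiD_fin3_eq]; exact subset_union_right

/-- For a nonempty instance the two families coincide (`∅ = t \ t` is a (Θ)-difference). -/
theorem multiD_fin3_eq_of_nonempty (h : A.Nonempty ∨ B.Nonempty ∨ C.Nonempty) :
    multiD ![A, B, C] = thetaD A B C := by
  rw [multiD_fin3_eq]
  apply Subset.antisymm _ subset_union_right
  intro E hE
  rw [mem_union, mem_singleton] at hE
  rcases hE with rfl | hE
  · rcases h with ⟨t, ht⟩ | ⟨t, ht⟩ | ⟨t, ht⟩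
    · exact mem_thetaD_of_mem_diffs_left (mem_diffs.2 ⟨t, ht, t, ht, by simp⟩)
    · exact mem_thetaD_of_mem_diffs_mid (mem_diffs.2 ⟨t, ht, t, ht, by simp⟩)
    · exact mem_thetaD_of_mem_diffs_right (mem_diffs.2 ⟨t, ht, t, ht, by simp⟩)
  · exact hE

/-- Validity of three classes is the cell's `ThetaValid`. -/
theorem multiValid_fin3_iff : MultiValid ![A, B, C] ↔ ThetaValid A B C := by
  constructor
  · rintro ⟨h1, h2⟩
    exact ⟨h1 0, h1 1, h1 2, (h2 0 1 (by decide)).1, (h2 1 2 (by decide)).1,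
      (h2 2 0 (by decide)).1, (h2 0 1 (by decide)).2, (h2 1 2 (by decide)).2,
      (h2 2 0 (by decide)).2⟩
  · rintro ⟨hA, hB, hC, hAB, hBC, hCA, hAB', hBC', hCA'⟩
    refine ⟨?_, ?_⟩
    · intro i; fin_cases i
      · exact hA
      · exact hB
      · exact hC
    · intro i j hij; fin_cases i <;> fin_cases j
      · exact absurd rfl hij
      · exact ⟨hAB, hAB'⟩
      · exact ⟨hCA.symm, disjoint_compls_comm hCA'⟩
      · exact ⟨hAB.symm, disjoint_compls_comm hAB'⟩
      · exact absurd rfl hij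
      · exact ⟨hBC, hBC'⟩
      · exact ⟨hCA, hCA'⟩
      · exact ⟨hBC.symm, disjoint_compls_comm hBC'⟩
      · exact absurd rfl hij

/-- **(Θ_∞) implies (Θ)**: the three-class case of the conjecture is the cell's statement. -/
theorem theta_of_conjThetaMulti (hconj : ConjThetaMulti α) {A B C : Finset (Finset α)}
    (h : ThetaValid A B C) : A.card + B.card + C.card ≤ (thetaD A B C).card := by
  have hm := hconj 3 ![A, B, C] ((multiValid_fin3_iff A B C).2 h)
  rw [Fin.sum_univ_three] at hm
  simp only [Matrix.cons_val_zero, Matrix.cons_val_one, Matrix.head_cons, Matrix.cons_val_two,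
    Matrix.tail_cons] at hm
  by_cases hne : A.Nonempty ∨ B.Nonempty ∨ C.Nonempty
  · rwa [multiD_fin3_eq_of_nonempty A B C hne] at hm
  · have hA : A = ∅ := not_nonempty_iff_eq_empty.1 fun hA => hne (Or.inl hA)
    have hB : B = ∅ := not_nonempty_iff_eq_empty.1 fun hB => hne (Or.inr (Or.inl hB))
    have hC : C = ∅ := not_nonempty_iff_eq_empty.1 fun hC => hne (Or.inr (Or.inr hC))
    subst hA hB hC
    simp

/-- **The proven regime of (Θ) is the three-class case of (Θ_∞)**: whenever some class has at
most two members, `∑ᵢ |![A, B, C] i| ≤ |multiD ![A, B, C]|`. -/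
theorem multi_three_of_some_card_le_two (h : ThetaValid A B C)
    (hsmall : A.card ≤ 2 ∨ B.card ≤ 2 ∨ C.card ≤ 2) :
    ∑ i, (![A, B, C] i).card ≤ (multiD ![A, B, C]).card := by
  rw [Fin.sum_univ_three]
  simp only [Matrix.cons_val_zero, Matrix.cons_val_one, Matrix.head_cons, Matrix.cons_val_two,
    Matrix.tail_cons]
  exact (theta_card_le_of_some_card_le_two h hsmall).trans
    (card_le_card (thetaD_subset_multiD_fin3 A B C))

end Small

end PercRepro.MSTight
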